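import Summits.HubbardSuperconductivity.HubbardSuperconductivity.Theorems.KLProgrammeKLRegimeScaleZeroBetaWindowCells

/-!
# Route `KLProgramme`, crux K3 — engine-flow child (stmt-HubbardSuperconductivity-20437), stub (C) at `n = 0`, located item #22a «(C)-SCALE0-PT2»,
# §2a (M), the TIME GRID: the engine's `ε`-weighted sum over the `N_g` grid times of a majorised profile is at most `(1 + N/N_g)` times the
# `N`-cell table sum — the grid twin of `…ScaleZeroBetaWindowCells` (D6)

Cell gate-hubbard-kl, seat p1 g20.  The door's rows are GRID sums `ε·Σ_{j<N_g} F(τ_j)`, `τ_j = jβ/N_g`, `ε = β/N_g` (`N_g = 4M`), not integrals; the certificate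
(D6 `sunsetShape_le_of_octaveTable`) is a table `M k`, `k < N`, of cell-wise upper bounds of `F` on the `N` cells `[βk/N, β(k+1)/N]`.  Counting the grid times
per cell (`≤ N_g/N + 1`) gives the `M`-UNIFORM reading, with no Lipschitz / total-variation input:

* §1 `card_gridTimes_in_cell_le` — `#{j < N_g : jβ/N_g ∈ [βk/N, β(k+1)/N]} ≤ N_g/N + 1` (as reals: `≤ N_g/N + 1`);
* §2 **`gridSum_le_of_cellTable`** — if `F(τ) ≤ M k` on the closed cell `k` for every `k < N`, then
  `ofReal(β/N_g)·Σ_{j<N_g} F(jβ/N_g) ≤ (ofReal(β/N) + ofReal(β/N_g))·Σ_{k<N} M k` (`F, M` valued in `ℝ≥0∞`; `0 < β`, `0 < N`, `0 < N_g`)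
  — for `N_g ≥ N` at most twice, and for the engine's `N_g = 4M ≥ 4klEngM₃` essentially once, the table's own Riemann sum `Σ_k (β/N)·M k`;
* §3 (appended) **`sum_shiftedGrid_eq_of_periodic`** — a row of the door is a sum over the SHIFTED grid `((j − j₀)β/N_g)_{j<N_g} ⊂ (−β, β)`; for a
  `β`-periodic majorant it equals the sum over the fundamental grid, so §2 reads every row; `tsum_profile_periodic` — the image-sum majorant
  `s ↦ Σ'_m p(s + mβ)` of `…OffSiteProfileBridge` is `β`-periodic.

Proofs only; no definitions; nothing here asserts (C), any stub of 20437, K3 or superconductivity.  References: BGM 2006 §2.1 (2.5)–(2.6a)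
[cite: BenfattoGiulianiMastropietro2006].
-/

noncomputable section

namespace Summit.HubbardSuperconductivity.HubbardSuperconductivity.Theorems.KLRegimeSplit

set_option linter.dupNamespace false -- summit = problem name (single-conjunct summit), D-0017

open MeasureTheory Set Finset Real
open scoped ENNReal NNReal

/-! ## §1 Counting grid times in a cell -/

/-- The grid times `jβ/N_g`, `j < N_g`, lying in the closed cell `[βk/N, β(k+1)/N]` have indices in the integer interval
`[⌈k N_g/N⌉, ⌊(k+1) N_g/N⌋]`, hence there are at most `N_g/N + 1` of them (`0 < β`, `0 < N`, `0 < N_g`). -/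
theorem card_gridTimes_in_cell_le {β : ℝ} (hβ : 0 < β) {Ng N : ℕ} (hNg : 0 < Ng) (hN : 0 < N) (k : ℕ) :
    (((Finset.range Ng).filter fun j : ℕ => β * k / N ≤ (j : ℝ) * β / Ng ∧ (j : ℝ) * β / Ng ≤ β * (k + 1) / N).card : ℝ) ≤ (Ng : ℝ) / N + 1 := by
  classical
  set S := (Finset.range Ng).filter fun j : ℕ => β * k / N ≤ (j : ℝ) * β / Ng ∧ (j : ℝ) * β / Ng ≤ β * (k + 1) / N with hS
  have hNr : (0 : ℝ) < N := by exact_mod_cast hN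
  have hNgr : (0 : ℝ) < Ng := by exact_mod_cast hNg
  -- every member `j` satisfies `k·Ng/N ≤ j ≤ (k+1)·Ng/N`
  have hmem : ∀ j ∈ S, (k : ℝ) * Ng / N ≤ j ∧ (j : ℝ) ≤ ((k : ℝ) + 1) * Ng / N := by
    intro j hj
    rw [hS, Finset.mem_filter] at hj
    obtain ⟨-, h1, h2⟩ := hj
    constructor
    · rw [div_le_iff₀ hNr]
      rw [div_le_div_iff₀ hNr hNgr] at h1
      nlinarith
    · rw [le_div_iff₀ hNr]
      rw [div_le_div_iff₀ hNgr hNr] at h2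
      nlinarith
  -- so `S` sits inside an integer interval of length `≤ Ng/N`
  by_cases hne : S.Nonempty
  · obtain ⟨a, ha⟩ := S.min_of_nonempty hne
    obtain ⟨b, hb⟩ := S.max_of_nonempty hne
    have haS := Finset.mem_of_min ha
    have hbS := Finset.mem_of_max hb
    have hsub : S ⊆ Finset.Icc a b := fun j hj => Finset.mem_Icc.2 ⟨Finset.min_le_of_eq hj ha, Finset.le_max_of_eq hj hb⟩
    have hcard : (S.card : ℝ) ≤ (b : ℝ) - a + 1 := by
      have h := Finset.card_le_card hsub
      rw [Nat.card_Icc] at h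
      have hab : a ≤ b := Finset.min_le_of_eq hbS ha |> fun h' => by exact_mod_cast h'
      have : ((b + 1 - a : ℕ) : ℝ) = (b : ℝ) - a + 1 := by
        rw [Nat.cast_sub (by omega)]; push_cast; ring
      calc (S.card : ℝ) ≤ ((b + 1 - a : ℕ) : ℝ) := by exact_mod_cast h
        _ = (b : ℝ) - a + 1 := this
    have h1 := (hmem a haS).1
    have h2 := (hmem b hbS).2
    calc (S.card : ℝ) ≤ (b : ℝ) - a + 1 := hcard
      _ ≤ (((k : ℝ) + 1) * Ng / N - (k : ℝ) * Ng / N) + 1 := by linarith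
      _ = (Ng : ℝ) / N + 1 := by field_simp; ring
  · rw [Finset.not_nonempty_iff_eq_empty] at hne
    rw [hne, Finset.card_empty, Nat.cast_zero]
    positivity

/-! ## §2 The grid sum under a cell table -/

/-- **GRID READER**: for `F, M : ℝ≥0∞`-valued, `0 < β`, `0 < N`, `0 < N_g`, if `F(τ) ≤ M k` for every `k < N` and every `τ` in the closed cell
`[βk/N, β(k+1)/N]`, then `ofReal(β/N_g)·Σ_{j<N_g} F(jβ/N_g) ≤ (ofReal(β/N) + ofReal(β/N_g))·Σ_{k<N} M k` — uniformly in the grid size. -/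
theorem gridSum_le_of_cellTable {β : ℝ} (hβ : 0 < β) {Ng N : ℕ} (hNg : 0 < Ng) (hN : 0 < N) (F : ℝ → ℝ≥0∞) (M : ℕ → ℝ≥0∞)
    (hF : ∀ k < N, ∀ τ : ℝ, β * k / N ≤ τ → τ ≤ β * (k + 1) / N → F τ ≤ M k) :
    ENNReal.ofReal (β / Ng) * ∑ j ∈ Finset.range Ng, F ((j : ℝ) * β / Ng) ≤
      (ENNReal.ofReal (β / N) + ENNReal.ofReal (β / Ng)) * ∑ k ∈ Finset.range N, M k := by
  classical
  have hNr : (0 : ℝ) < N := by exact_mod_cast hN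
  have hNgr : (0 : ℝ) < Ng := by exact_mod_cast hNg
  -- each grid time lies in some cell `k < N`
  have hcover : ∀ j ∈ Finset.range Ng, ∃ k < N, β * k / N ≤ (j : ℝ) * β / Ng ∧ (j : ℝ) * β / Ng ≤ β * (k + 1) / N := by
    intro j hj
    have hj' : (j : ℝ) < Ng := by exact_mod_cast Finset.mem_range.1 hj
    set t : ℝ := (j : ℝ) * β / Ng with ht
    have ht0 : 0 ≤ t := by positivity
    have htβ : t < β := by rw [ht, div_lt_iff₀ hNgr]; nlinarith
    -- k := ⌊t N / β⌋
    set k := ⌊t * N / β⌋₊ with hk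
    have hkle : (k : ℝ) ≤ t * N / β := Nat.floor_le (by positivity)
    have hklt : t * N / β < k + 1 := Nat.lt_floor_add_one _
    refine ⟨k, ?_, ?_, ?_⟩
    · have : (k : ℝ) < N := by
        calc (k : ℝ) ≤ t * N / β := hkle
          _ < β * N / β := by rw [div_lt_div_iff_of_pos_right hβ]; nlinarith
          _ = N := by field_simp
      exact_mod_cast this
    · rw [div_le_iff₀ hNr]; rw [le_div_iff₀ hβ] at hkle; linarith
    · rw [le_div_iff₀ hNr]; rw [div_lt_iff₀ hβ] at hklt; linarith
  -- pointwise: F(τ_j) ≤ Σ_k [τ_j ∈ cell k] M k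
  have hpt : ∀ j ∈ Finset.range Ng, F ((j : ℝ) * β / Ng) ≤
      ∑ k ∈ Finset.range N, (if β * k / N ≤ (j : ℝ) * β / Ng ∧ (j : ℝ) * β / Ng ≤ β * (k + 1) / N then M k else 0) := by
    intro j hj
    obtain ⟨k, hkN, h1, h2⟩ := hcover j hj
    calc F ((j : ℝ) * β / Ng) ≤ M k := hF k hkN _ h1 h2
      _ = (if β * k / N ≤ (j : ℝ) * β / Ng ∧ (j : ℝ) * β / Ng ≤ β * (k + 1) / N then M k else 0) := by rw [if_pos ⟨h1, h2⟩]
      _ ≤ ∑ k' ∈ Finset.range N, (if β * k' / N ≤ (j : ℝ) * β / Ng ∧ (j : ℝ) * β / Ng ≤ β * (k' + 1) / N then M k' else 0) :=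
          Finset.single_le_sum (f := fun k' : ℕ => (if β * k' / N ≤ (j : ℝ) * β / Ng ∧ (j : ℝ) * β / Ng ≤ β * (k' + 1) / N then M k' else 0))
            (fun _ _ => zero_le) (Finset.mem_range.2 hkN)
  -- sum over j, exchange, count
  have hsum : ∑ j ∈ Finset.range Ng, F ((j : ℝ) * β / Ng) ≤ ∑ k ∈ Finset.range N, ENNReal.ofReal ((Ng : ℝ) / N + 1) * M k := by
    calc ∑ j ∈ Finset.range Ng, F ((j : ℝ) * β / Ng)
        ≤ ∑ j ∈ Finset.range Ng, ∑ k ∈ Finset.range N,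
            (if β * k / N ≤ (j : ℝ) * β / Ng ∧ (j : ℝ) * β / Ng ≤ β * (k + 1) / N then M k else 0) := Finset.sum_le_sum hpt
      _ = ∑ k ∈ Finset.range N, ∑ j ∈ Finset.range Ng,
            (if β * k / N ≤ (j : ℝ) * β / Ng ∧ (j : ℝ) * β / Ng ≤ β * (k + 1) / N then M k else 0) := Finset.sum_comm
      _ = ∑ k ∈ Finset.range N, (((Finset.range Ng).filter fun j : ℕ =>
            β * k / N ≤ (j : ℝ) * β / Ng ∧ (j : ℝ) * β / Ng ≤ β * (k + 1) / N).card : ℝ≥0∞) * M k := by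
          refine Finset.sum_congr rfl fun k _ => ?_
          rw [← Finset.sum_filter, Finset.sum_const, nsmul_eq_mul]
      _ ≤ ∑ k ∈ Finset.range N, ENNReal.ofReal ((Ng : ℝ) / N + 1) * M k := by
          refine Finset.sum_le_sum fun k _ => ?_
          gcongr
          have h := card_gridTimes_in_cell_le hβ hNg hN k
          rw [← ENNReal.ofReal_natCast]
          exact ENNReal.ofReal_le_ofReal h
  calc ENNReal.ofReal (β / Ng) * ∑ j ∈ Finset.range Ng, F ((j : ℝ) * β / Ng)
      ≤ ENNReal.ofReal (β / Ng) * ∑ k ∈ Finset.range N, ENNReal.ofReal ((Ng : ℝ) / N + 1) * M k := by gcongr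
    _ = (ENNReal.ofReal (β / Ng) * ENNReal.ofReal ((Ng : ℝ) / N + 1)) * ∑ k ∈ Finset.range N, M k := by
        rw [Finset.mul_sum, Finset.mul_sum]
        exact Finset.sum_congr rfl fun k _ => by ring
    _ = (ENNReal.ofReal (β / N) + ENNReal.ofReal (β / Ng)) * ∑ k ∈ Finset.range N, M k := by
        congr 1
        rw [← ENNReal.ofReal_mul (by positivity), ← ENNReal.ofReal_add (by positivity) (by positivity)]
        congr 1
        field_simp

/-! ## §3 Rows of the door are sums over SHIFTED grid times: periodic re-indexing -/

/-- **Periodic re-indexing of a grid row**: for a `β`-periodic `F` and a base index `j₀ < N_g`, the row sum over the shifted grid times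
`((j − j₀)β/N_g)_{j<N_g}` (which range over `(−β, β)`) equals the sum over the fundamental grid `(jβ/N_g)_{j<N_g}`:
`Σ_{j<N_g} F((j−j₀)β/N_g) = Σ_{j<N_g} F(jβ/N_g)` — so `gridSum_le_of_cellTable` reads every row of the door. -/
theorem sum_shiftedGrid_eq_of_periodic {α : Type*} [AddCommMonoid α] {F : ℝ → α} {β : ℝ} (hF : ∀ t : ℝ, F (t + β) = F t)
    {Ng j₀ : ℕ} (hj₀ : j₀ < Ng) :
    ∑ j ∈ Finset.range Ng, F ((((j : ℤ) - j₀ : ℤ) : ℝ) * β / Ng) = ∑ j ∈ Finset.range Ng, F ((j : ℝ) * β / Ng) := by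
  have hNg : (0 : ℝ) < Ng := by exact_mod_cast (Nat.zero_lt_of_lt hj₀)
  have hF' : ∀ t : ℝ, F (t - β) = F t := fun t => by rw [← hF (t - β), sub_add_cancel]
  -- split the left sum at `j₀`
  rw [Finset.range_eq_Ico, ← Finset.sum_Ico_consecutive _ (Nat.zero_le j₀) hj₀.le]
  -- the upper part: `j = j₀ + i`, `i < Ng − j₀`
  have hup : ∑ j ∈ Finset.Ico j₀ Ng, F ((((j : ℤ) - j₀ : ℤ) : ℝ) * β / Ng) = ∑ i ∈ Finset.range (Ng - j₀), F ((i : ℝ) * β / Ng) := by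
    rw [Finset.sum_Ico_eq_sum_range]
    refine Finset.sum_congr rfl fun i _ => ?_
    congr 1
    push_cast
    ring
  -- the lower part: `j < j₀`, shifted by one period: `(j − j₀)β/N_g = (j + N_g − j₀)β/N_g − β`
  have hlo : ∑ j ∈ Finset.Ico 0 j₀, F ((((j : ℤ) - j₀ : ℤ) : ℝ) * β / Ng) = ∑ i ∈ Finset.Ico (Ng - j₀) Ng, F ((i : ℝ) * β / Ng) := by
    have h2 : ∑ i ∈ Finset.Ico (Ng - j₀) Ng, F ((i : ℝ) * β / Ng) = ∑ j ∈ Finset.range (Ng - (Ng - j₀)), F ((((Ng - j₀ + j : ℕ) : ℝ)) * β / Ng) := by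
      rw [Finset.sum_Ico_eq_sum_range]
    rw [h2, show Ng - (Ng - j₀) = j₀ by omega, ← Finset.range_eq_Ico]
    refine Finset.sum_congr rfl fun j hj => ?_
    have hj' := Finset.mem_range.1 hj
    rw [← hF' (((Ng - j₀ + j : ℕ) : ℝ) * β / Ng)]
    congr 1
    have : ((Ng - j₀ + j : ℕ) : ℝ) = (Ng : ℝ) - j₀ + j := by
      rw [Nat.cast_add, Nat.cast_sub hj₀.le]
    rw [this]
    push_cast
    field_simp
    ring
  rw [hlo, hup, add_comm, Finset.range_eq_Ico, Finset.sum_Ico_consecutive _ (Nat.zero_le _) (Nat.sub_le Ng j₀), ← Finset.range_eq_Ico]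

/-- The image-sum majorant of a profile is `β`-periodic: `Σ'_m p(s + β + mβ) = Σ'_m p(s + mβ)` — the `hF` of `sum_shiftedGrid_eq_of_periodic` for the
profile readings of `…OffSiteProfileBridge`. -/
theorem tsum_profile_periodic (p : ℝ → ℝ≥0∞) (β s : ℝ) : ∑' m : ℤ, p (s + β + m * β) = ∑' m : ℤ, p (s + m * β) := by
  rw [← (Equiv.addRight (1 : ℤ)).tsum_eq (fun m : ℤ => p (s + m * β))]
  refine tsum_congr fun m => ?_
  simp only [Equiv.coe_addRight]
  congr 1
  push_cast
  ring

end Summit.HubbardSuperconductivity.HubbardSuperconductivity.Theorems.KLRegimeSplit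

end
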